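import Literature.Analysis.FluidPDE.ClassicalL2Stability
import Literature.Analysis.FluidPDE.MollifiedLimits
import Literature.Analysis.FunctionSpaces.SobolevImbeddingSup
import Literature.Analysis.FunctionSpaces.RegularizedDistance
import Mathlib.Analysis.Calculus.SmoothSeries
import HarnessLib

/-!
# Smooth representatives of `L²` limits of smooth fields with uniformly bounded Sobolev norms

Analysis/FluidPDE proof file (no named facts). **Completeness of `H^∞(ℝ³)` in the smooth
category**: if smooth fields `f n : ℝ³ → ℝ³` converge in `L²` to `f` and, for every order `k`,
`∫ ‖Dᵏ(f n)‖² ≤ C k` uniformly in `n`, then `f` has a `C^∞` representative `g` (`g = f` a.e.) with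
`∫ ‖Dᵏg‖² ≤ C k` for every `k`; if the `f n` are divergence free, so is `g`
(`exists_smooth_representative`). Folklore (interpolation `‖Dᵐh‖²₂ ≲ ‖D^{m-1}h‖₂ ‖D^{m+1}h‖₂`,
the Sobolev imbedding `H²(ℝ³) ⊂ C_B(ℝ³)`, so that `(f n)` is Cauchy in every `Cᵏ` sup-seminorm,
a telescoping series with summable sup bounds, Mathlib `contDiff_tsum_of_eventually`, and Fatou).
It is the "smooth for positive times" step of the decomposition of
`tao2011_H1_local_almost_regular`: the approximating classical solutions have all Sobolev norms
bounded uniformly at positive times (`tao2011_quantitative_regularity`), so the limit Leray–Hopf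
solution has smooth `H^∞` slices there, from which the smooth local theory restarts
(Robinson–Rodrigo–Sadowski 2016, proof of Thm. 7.3; Tao 2013, Prop. 5.6).

## Contents

* `vderiv α v` — iterated directional derivatives of a vector field along the standard frame,
  indexed by words `α : Fin m → Fin 3`; this is the word-indexed form of the tree's list-indexed
  `FunctionSpaces.iterDirDeriv` (`vderiv_eq_iterDirDeriv`), kept because the interpolation below
  sums over the `Fintype` of words of fixed length and recurses on `Fin.tail`; with
  `Σ_α ‖∂^α v‖² = |∇ᵐv|²` (`sum_sq_norm_vderiv_eq_levelSq`) and `‖Dⁿ(∂^α v)‖ ≤ ‖D^{n+m} v‖`;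
* `sum_integral_sq_vderiv_succ_le` — the one-step interpolation
  `Σ_{|α|=m+1} ∫‖∂^αh‖² ≤ 3 Σ_{|α|=m} ‖∂^αh‖₂ ‖D^{m+2}h‖₂`;
* `exists_smooth_representative` — the theorem.

## References

* J. C. Robinson, J. L. Rodrigo, W. Sadowski, CUP 2016, proof of Thm. 7.3 and Thm. 1.20/1.21
  (Agmon / Sobolev imbeddings). [RobinsonRodrigoSadowski2016]
* R. A. Adams, *Sobolev Spaces*, Academic Press 1975, Thm. 5.4 (imbedding `W^{2,2}(ℝ³) → C_B`).
  [Adams1975]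
-/

noncomputable section

open MeasureTheory Set Function Filter Topology InnerProductSpace
open scoped ENNReal NNReal ContDiff RealInnerProductSpace Laplacian BigOperators

namespace Literature.Analysis.FluidPDE

/-! ### Iterated directional derivatives of vector fields along the standard frame -/

section Words

/-- `vderiv α v`: the iterated directional derivative `∂_{α 0} ∂_{α 1} ⋯ ∂_{α (m-1)} v` of a
vector field `v : ℝ³ → ℝ³` along the standard orthonormal frame, for a word `α : Fin m → Fin 3`
(outermost letter first, as `ipderiv` of `CoordDerivatives.lean` for scalar functions). It is the
word-indexed form of the tree's `FunctionSpaces.iterDirDeriv` (list of directions):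
`vderiv α v = iterDirDeriv [e_{α 0}, …, e_{α (m-1)}] v` (`vderiv_eq_iterDirDeriv`); the twin is
kept, as `pderiv`/`partialDeriv` in `CoordDerivatives.lean`, because the estimates below sum over
the `Fintype` `Fin m → Fin 3` of words of fixed length and recurse on `Fin.tail`. [folklore] -/
def vderiv : {m : ℕ} → (Fin m → Fin 3) →
    (EuclideanSpace ℝ (Fin 3) → EuclideanSpace ℝ (Fin 3)) →
      EuclideanSpace ℝ (Fin 3) → EuclideanSpace ℝ (Fin 3)
  | 0, _, v => v
  | _ + 1, α, v => fun x => fderiv ℝ (vderiv (Fin.tail α) v) x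
      (EuclideanSpace.basisFun (Fin 3) ℝ (α 0))

/-- The empty word does nothing. [folklore] -/
@[simp]
theorem vderiv_zero (α : Fin 0 → Fin 3) (v : EuclideanSpace ℝ (Fin 3) → EuclideanSpace ℝ (Fin 3)) :
    vderiv α v = v := rfl

/-- Unfolding one letter (outermost first). [folklore] -/
theorem vderiv_succ {m : ℕ} (α : Fin (m + 1) → Fin 3)
    (v : EuclideanSpace ℝ (Fin 3) → EuclideanSpace ℝ (Fin 3)) :
    vderiv α v = fun x => fderiv ℝ (vderiv (Fin.tail α) v) x
      (EuclideanSpace.basisFun (Fin 3) ℝ (α 0)) := rfl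

/-- **Bridge to the tree's list-indexed iterated directional derivative**:
`vderiv α v = FunctionSpaces.iterDirDeriv [e_{α 0}, …, e_{α (m-1)}] v`. [folklore] -/
theorem vderiv_eq_iterDirDeriv {v : EuclideanSpace ℝ (Fin 3) → EuclideanSpace ℝ (Fin 3)} :
    ∀ {m : ℕ} (α : Fin m → Fin 3), vderiv α v =
      FunctionSpaces.iterDirDeriv (List.ofFn fun i => EuclideanSpace.basisFun (Fin 3) ℝ (α i)) v
  | 0, α => by rw [vderiv_zero, List.ofFn_zero, FunctionSpaces.iterDirDeriv_nil]
  | m + 1, α => by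
      rw [vderiv_succ, List.ofFn_succ, FunctionSpaces.iterDirDeriv_cons,
        vderiv_eq_iterDirDeriv (Fin.tail α)]
      rfl

/-- Word derivatives of smooth fields are smooth. [folklore] -/
theorem contDiff_vderiv {v : EuclideanSpace ℝ (Fin 3) → EuclideanSpace ℝ (Fin 3)}
    (hv : ContDiff ℝ ∞ v) : ∀ {m : ℕ} (α : Fin m → Fin 3), ContDiff ℝ ∞ (vderiv α v)
  | 0, _ => hv
  | _ + 1, α => by
      rw [vderiv_succ]
      exact ((contDiff_vderiv hv (Fin.tail α)).fderiv_right (m := ∞) (by norm_cast)).clm_apply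
        contDiff_const

/-- Word derivatives are linear: `∂^α (v - w) = ∂^α v - ∂^α w`. [folklore] -/
theorem vderiv_sub {v w : EuclideanSpace ℝ (Fin 3) → EuclideanSpace ℝ (Fin 3)}
    (hv : ContDiff ℝ ∞ v) (hw : ContDiff ℝ ∞ w) :
    ∀ {m : ℕ} (α : Fin m → Fin 3), vderiv α (fun x => v x - w x) = fun x => vderiv α v x - vderiv α w x
  | 0, _ => rfl
  | _ + 1, α => by
      rw [vderiv_succ, vderiv_succ, vderiv_succ, vderiv_sub hv hw (Fin.tail α)]
      funext x
      have hdv : DifferentiableAt ℝ (vderiv (Fin.tail α) v) x :=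
        ((contDiff_vderiv hv (Fin.tail α)).differentiable (by simp)) x
      have hdw : DifferentiableAt ℝ (vderiv (Fin.tail α) w) x :=
        ((contDiff_vderiv hw (Fin.tail α)).differentiable (by simp)) x
      rw [fderiv_fun_sub hdv hdw, FunLike.coe_sub, Pi.sub_apply]

/-- **`‖Dⁿ(∂^α v)(x)‖ ≤ ‖D^{n+m} v(x)‖`** for a word of length `m` (each letter is a unit vector;
`norm_iteratedFDeriv_fderiv_apply_basisFun_le`). [folklore] -/
theorem norm_iteratedFDeriv_vderiv_le {v : EuclideanSpace ℝ (Fin 3) → EuclideanSpace ℝ (Fin 3)}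
    (hv : ContDiff ℝ ∞ v) : ∀ {m : ℕ} (α : Fin m → Fin 3) (n : ℕ) (x : EuclideanSpace ℝ (Fin 3)),
      ‖iteratedFDeriv ℝ n (vderiv α v) x‖ ≤ ‖iteratedFDeriv ℝ (n + m) v x‖
  | 0, _, n, x => by simp
  | m + 1, α, n, x => by
      rw [vderiv_succ]
      calc ‖iteratedFDeriv ℝ n (fun y => fderiv ℝ (vderiv (Fin.tail α) v) y
            (EuclideanSpace.basisFun (Fin 3) ℝ (α 0))) x‖
          ≤ ‖iteratedFDeriv ℝ (n + 1) (vderiv (Fin.tail α) v) x‖ :=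
            norm_iteratedFDeriv_fderiv_apply_basisFun_le (contDiff_vderiv hv (Fin.tail α)) n
              (by exact_mod_cast le_top) x (α 0)
        _ ≤ ‖iteratedFDeriv ℝ (n + 1 + m) v x‖ := norm_iteratedFDeriv_vderiv_le hv (Fin.tail α) (n + 1) x
        _ = ‖iteratedFDeriv ℝ (n + (m + 1)) v x‖ := by rw [show n + 1 + m = n + (m + 1) by ring]

/-- Components of the word derivatives are the coordinate word derivatives of the components:
`(∂^α v (x))ᵢ = ∂^α vᵢ (x)` (`ipderiv` of `CoordDerivatives.lean`). [folklore] -/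
theorem vderiv_apply_eq_ipderiv {v : EuclideanSpace ℝ (Fin 3) → EuclideanSpace ℝ (Fin 3)}
    (hv : ContDiff ℝ ∞ v) : ∀ {m : ℕ} (α : Fin m → Fin 3) (x : EuclideanSpace ℝ (Fin 3)) (i : Fin 3),
      vderiv α v x i = ipderiv α (fun y => v y i) x
  | 0, _, _, _ => rfl
  | _ + 1, α, x, i => by
      rw [vderiv_succ, ipderiv_succ, pderiv_apply, stdVec_eq_basisFun]
      have hd : DifferentiableAt ℝ (vderiv (Fin.tail α) v) x :=
        ((contDiff_vderiv hv (Fin.tail α)).differentiable (by simp)) x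
      rw [euclidean_fderiv_apply_comp hd]
      congr 2
      funext y
      exact vderiv_apply_eq_ipderiv hv (Fin.tail α) y i

/-- **`Σ_α ‖∂^α v (x)‖² = |∇ᵐ v (x)|²`**: the sum over words of length `m` of the squared word
derivatives is the coordinate tensor `levelSq m v x` of `CoordDerivatives.lean`. [folklore] -/
theorem sum_sq_norm_vderiv_eq_levelSq {v : EuclideanSpace ℝ (Fin 3) → EuclideanSpace ℝ (Fin 3)}
    (hv : ContDiff ℝ ∞ v) (m : ℕ) (x : EuclideanSpace ℝ (Fin 3)) :
    ∑ α : Fin m → Fin 3, ‖vderiv α v x‖ ^ 2 = levelSq m v x := by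
  unfold levelSq dnormSq
  rw [Finset.sum_comm]
  refine Finset.sum_congr rfl fun α _ => ?_
  rw [EuclideanSpace.real_norm_sq_eq]
  exact Finset.sum_congr rfl fun i _ => by rw [vderiv_apply_eq_ipderiv hv α x i]

end Words

/-! ### The one-step interpolation inequality -/

section Interpolation

/-- Words of length `m + 1` split by their first letter:
`∂^{l :: β} v = ∂_l (∂^β v)`. [folklore] -/
theorem vderiv_cons {m : ℕ} (l : Fin 3) (β : Fin m → Fin 3)
    (v : EuclideanSpace ℝ (Fin 3) → EuclideanSpace ℝ (Fin 3)) :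
    vderiv (Fin.cons l β : Fin (m + 1) → Fin 3) v =
      fun x => fderiv ℝ (vderiv β v) x (EuclideanSpace.basisFun (Fin 3) ℝ l) := by
  rw [vderiv_succ]
  simp

set_option maxHeartbeats 800000 in
/-- **One-step interpolation** `Σ_{|α|=m+1} ∫‖∂^αh‖² ≤ 3 Σ_{|α|=m} ‖∂^αh‖₂ ‖D^{m+2}h‖₂` for a
smooth field on `ℝ³` with `D^m h, D^{m+1} h, D^{m+2} h ∈ L²`: for each word `α` of length `m`,
with `V = ∂^α h`, `Σₗ ∫‖∂ₗV‖² = ∫|∇V|² = −∫⟪ΔV, V⟫ ≤ ‖V‖₂ ‖ΔV‖₂ ≤ 3‖V‖₂‖D²V‖₂` (Green's identity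
`integral_sum_inner_fderiv_fderiv_eq_neg_integral_inner_laplacian`, Cauchy–Schwarz, and
`‖D²(∂^αh)‖ ≤ ‖D^{m+2}h‖`). (Long bookkeeping; heartbeat budget raised for this declaration.) [folklore] -/
theorem sum_integral_sq_vderiv_succ_le {h : EuclideanSpace ℝ (Fin 3) → EuclideanSpace ℝ (Fin 3)}
    (hh : ContDiff ℝ ∞ h) (m : ℕ) (hm : ∫⁻ x, ‖iteratedFDeriv ℝ m h x‖ₑ ^ 2 < ⊤)
    (hm1 : ∫⁻ x, ‖iteratedFDeriv ℝ (m + 1) h x‖ₑ ^ 2 < ⊤)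
    (hm2 : ∫⁻ x, ‖iteratedFDeriv ℝ (m + 2) h x‖ₑ ^ 2 < ⊤) :
    ∑ α : Fin (m + 1) → Fin 3, ∫ x, ‖vderiv α h x‖ ^ 2 ≤
      3 * ∑ β : Fin m → Fin 3, Real.sqrt (∫ x, ‖vderiv β h x‖ ^ 2) *
        Real.sqrt (∫ x, ‖iteratedFDeriv ℝ (m + 2) h x‖ ^ 2) := by
  set e := EuclideanSpace.basisFun (Fin 3) ℝ with he
  rw [sum_word_succ, Finset.sum_comm, Finset.mul_sum]
  refine Finset.sum_le_sum fun β _ => ?_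
  -- the field `V = ∂^β h` and its `L²` data
  set V : EuclideanSpace ℝ (Fin 3) → EuclideanSpace ℝ (Fin 3) := vderiv β h with hVdef
  have hV : ContDiff ℝ ∞ V := contDiff_vderiv hh β
  have hV2 : ContDiff ℝ 2 V := hV.of_le (by norm_cast)
  have hV1 : ContDiff ℝ 1 V := hV.of_le (by norm_cast)
  have l2V0 : ∫⁻ x, ‖V x‖ₑ ^ 2 < ⊤ :=
    lintegral_enorm_sq_lt_top_of_norm_le (fun x => by
      have := norm_iteratedFDeriv_vderiv_le hh β 0 x
      rw [norm_iteratedFDeriv_zero, zero_add] at this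
      exact this) hm
  have l2V1 : ∫⁻ x, ‖iteratedFDeriv ℝ 1 V x‖ₑ ^ 2 < ⊤ :=
    lintegral_enorm_sq_lt_top_of_norm_le (fun x => by
      have := norm_iteratedFDeriv_vderiv_le hh β 1 x
      rw [show 1 + m = m + 1 by ring] at this
      exact this) hm1
  have l2V2 : ∫⁻ x, ‖iteratedFDeriv ℝ 2 V x‖ₑ ^ 2 < ⊤ :=
    lintegral_enorm_sq_lt_top_of_norm_le (fun x => by
      have := norm_iteratedFDeriv_vderiv_le hh β 2 x
      rw [show 2 + m = m + 2 by ring] at this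
      exact this) hm2
  -- continuity
  have cV : Continuous V := hV.continuous
  have cDV : Continuous (fderiv ℝ V) := hV.continuous_fderiv (by simp)
  have cD2 : Continuous fun x => iteratedFDeriv ℝ 2 V x := hV2.continuous_iteratedFDeriv le_rfl
  have cdiV : ∀ i, Continuous fun x => fderiv ℝ V x (e i) := fun i => cDV.clm_apply continuous_const
  have cddV : ∀ i, Continuous fun x => fderiv ℝ (fun y => fderiv ℝ V y (e i)) x (e i) := fun i =>
    ((((hV.fderiv_right (m := 1) (by norm_cast)).clm_apply contDiff_const).continuous_fderiv
      (by norm_num)).clm_apply continuous_const)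
  have hΔ : ContDiff ℝ 1 (Δ V) := contDiff_one_laplacian_of_contDiff_three (hV.of_le (by norm_cast))
  have cΔ : Continuous (Δ V) := hΔ.continuous
  have c3D2 : Continuous fun x => (3 : ℝ) • iteratedFDeriv ℝ 2 V x := cD2.const_smul (3 : ℝ)
  -- `L²` finiteness of the slices
  have hDV_eq : ∀ x, ‖fderiv ℝ V x‖ = ‖iteratedFDeriv ℝ 1 V x‖ := fun x => by
    rw [← norm_iteratedFDeriv_fderiv, norm_iteratedFDeriv_zero]
  have l2DV : ∫⁻ x, ‖fderiv ℝ V x‖ₑ ^ 2 < ⊤ :=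
    lintegral_enorm_sq_lt_top_of_norm_le (fun x => (hDV_eq x).le) l2V1
  have he1 : ∀ i, ‖e i‖ = 1 := fun i => by simp [he]
  have l2diV : ∀ i, ∫⁻ x, ‖fderiv ℝ V x (e i)‖ₑ ^ 2 < ⊤ := fun i =>
    lintegral_enorm_sq_lt_top_of_norm_le (fun x => by
      simpa [he1] using (fderiv ℝ V x).le_opNorm (e i)) l2DV
  have l2ddV : ∀ i, ∫⁻ x, ‖fderiv ℝ (fun y => fderiv ℝ V y (e i)) x (e i)‖ₑ ^ 2 < ⊤ := fun i =>
    lintegral_enorm_sq_lt_top_of_norm_le (fun x => norm_fderiv_fderiv_apply_basisFun_le hV2 x i) l2V2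
  have n_Δ : ∀ x, ‖(Δ V) x‖ ≤ ‖(3 : ℝ) • iteratedFDeriv ℝ 2 V x‖ := fun x => by
    rw [norm_smul, Real.norm_of_nonneg (by norm_num : (0 : ℝ) ≤ 3)]
    exact norm_laplacian_le_three_mul_norm_iteratedFDeriv_two hV2 x
  have l2_3D2 : ∫⁻ x, ‖(3 : ℝ) • iteratedFDeriv ℝ 2 V x‖ₑ ^ 2 < ⊤ :=
    lintegral_enorm_sq_const_smul_lt_top 3 l2V2
  -- integrability of the pairings
  have i1 : ∀ i, Integrable (fun x => ⟪fderiv ℝ (fun y => fderiv ℝ V y (e i)) x (e i), V x⟫) volume :=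
    fun i => integrable_of_norm_le_mul_of_lintegral_sq ((cddV i).inner cV).aestronglyMeasurable
      (cddV i) cV (l2ddV i) l2V0 fun x => norm_inner_le_norm _ _
  have i2 : ∀ i, Integrable (fun x => ⟪fderiv ℝ V x (e i), fderiv ℝ V x (e i)⟫) volume := fun i =>
    integrable_of_norm_le_mul_of_lintegral_sq ((cdiV i).inner (cdiV i)).aestronglyMeasurable
      (cdiV i) (cdiV i) (l2diV i) (l2diV i) fun x => norm_inner_le_norm _ _
  have i3 : ∀ i, Integrable (fun x => ⟪fderiv ℝ V x (e i), V x⟫) volume := fun i =>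
    integrable_of_norm_le_mul_of_lintegral_sq ((cdiV i).inner cV).aestronglyMeasurable
      (cdiV i) cV (l2diV i) l2V0 fun x => norm_inner_le_norm _ _
  have iΔV : Integrable (fun x => ⟪(Δ V) x, V x⟫) volume :=
    integrable_of_norm_le_mul_of_lintegral_sq (cΔ.inner cV).aestronglyMeasurable c3D2 cV l2_3D2 l2V0
      fun x => (norm_inner_le_norm _ _).trans (mul_le_mul_of_nonneg_right (n_Δ x) (norm_nonneg _))
  have iprod : Integrable (fun x => ‖(Δ V) x‖ * ‖V x‖) volume :=
    integrable_of_norm_le_mul_of_lintegral_sq ((cΔ.norm.mul cV.norm).aestronglyMeasurable)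
      c3D2 cV l2_3D2 l2V0 fun x => by
        rw [Real.norm_of_nonneg (mul_nonneg (norm_nonneg _) (norm_nonneg _))]
        exact mul_le_mul_of_nonneg_right (n_Δ x) (norm_nonneg _)
  -- Green's identity and the left-hand side
  have hG := integral_sum_inner_fderiv_fderiv_eq_neg_integral_inner_laplacian hV2 hV1 i1 i2 i3
  have hlhs : ∑ l, ∫ x, ‖vderiv (Fin.cons l β : Fin (m + 1) → Fin 3) h x‖ ^ 2 =
      ∫ x, ∑ i, ⟪fderiv ℝ V x (e i), fderiv ℝ V x (e i)⟫ := by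
    rw [integral_finsetSum _ fun i _ => i2 i]
    refine Finset.sum_congr rfl fun l _ => ?_
    rw [vderiv_cons]
    refine integral_congr_ae (Eventually.of_forall fun x => ?_)
    simp only
    rw [real_inner_self_eq_norm_sq]
  rw [hlhs, hG]
  -- Cauchy–Schwarz and `‖ΔV‖ ≤ 3‖D²V‖ ≤ 3‖D^{m+2} h‖`
  have hVm : MemLp V 2 volume := ⟨cV.aestronglyMeasurable, eLpNorm_two_lt_top_of_lintegral_enorm_sq_lt_top l2V0⟩
  have hΔm : MemLp (Δ V) 2 volume := ⟨cΔ.aestronglyMeasurable,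
    eLpNorm_two_lt_top_of_lintegral_enorm_sq_lt_top (lintegral_enorm_sq_lt_top_of_norm_le n_Δ l2_3D2)⟩
  have hCS := integral_norm_mul_norm_le_sqrt_mul_sqrt hΔm hVm
  have habs : -∫ x, ⟪(Δ V) x, V x⟫ ≤ ∫ x, ‖(Δ V) x‖ * ‖V x‖ := by
    rw [← integral_neg]
    refine integral_mono iΔV.neg iprod fun x => ?_
    exact (neg_le_abs _).trans (by rw [← Real.norm_eq_abs]; exact norm_inner_le_norm _ _)
  have hΔD2 : ∫ x, ‖(Δ V) x‖ ^ 2 ≤ 9 * ∫ x, ‖iteratedFDeriv ℝ (m + 2) h x‖ ^ 2 := by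
    have iD2h : Integrable (fun x => ‖iteratedFDeriv ℝ (m + 2) h x‖ ^ 2) volume :=
      FluidPDE.integrable_sq_norm_of_lintegral_lt_top
        (hh.continuous_iteratedFDeriv (m := m + 2) (WithTop.coe_le_coe.2 le_top)) hm2
    rw [← integral_const_mul]
    refine integral_mono ((memLp_two_iff_integrable_sq_norm hΔm.1).1 hΔm) (iD2h.const_mul 9)
      fun x => ?_
    have h2 : ‖(3 : ℝ) • iteratedFDeriv ℝ 2 V x‖ ≤ 3 * ‖iteratedFDeriv ℝ (m + 2) h x‖ := by
      rw [norm_smul, Real.norm_of_nonneg (by norm_num : (0:ℝ) ≤ 3)]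
      refine mul_le_mul_of_nonneg_left ?_ (by norm_num)
      have := norm_iteratedFDeriv_vderiv_le hh β 2 x
      rw [show 2 + m = m + 2 by ring] at this
      exact this
    have h1 := (n_Δ x).trans h2
    have h0 := norm_nonneg ((Δ V) x)
    simp only
    nlinarith [h1, h0]
  have hsqrt : Real.sqrt (∫ x, ‖(Δ V) x‖ ^ 2) ≤ 3 * Real.sqrt (∫ x, ‖iteratedFDeriv ℝ (m + 2) h x‖ ^ 2) := by
    calc Real.sqrt (∫ x, ‖(Δ V) x‖ ^ 2) ≤ Real.sqrt (9 * ∫ x, ‖iteratedFDeriv ℝ (m + 2) h x‖ ^ 2) :=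
          Real.sqrt_le_sqrt hΔD2
      _ = 3 * Real.sqrt (∫ x, ‖iteratedFDeriv ℝ (m + 2) h x‖ ^ 2) := by
          rw [Real.sqrt_mul (by norm_num), show (9:ℝ) = 3 ^ 2 by norm_num, Real.sqrt_sq (by norm_num)]
  have hV0 : 0 ≤ Real.sqrt (∫ x, ‖V x‖ ^ 2) := Real.sqrt_nonneg _
  calc -∫ x, ⟪(Δ V) x, V x⟫ ≤ ∫ x, ‖(Δ V) x‖ * ‖V x‖ := habs
    _ ≤ Real.sqrt (∫ x, ‖(Δ V) x‖ ^ 2) * Real.sqrt (∫ x, ‖V x‖ ^ 2) := hCS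
    _ ≤ (3 * Real.sqrt (∫ x, ‖iteratedFDeriv ℝ (m + 2) h x‖ ^ 2)) * Real.sqrt (∫ x, ‖V x‖ ^ 2) :=
        mul_le_mul_of_nonneg_right hsqrt hV0
    _ = 3 * (Real.sqrt (∫ x, ‖vderiv β h x‖ ^ 2) * Real.sqrt (∫ x, ‖iteratedFDeriv ℝ (m + 2) h x‖ ^ 2)) := by
        rw [hVdef]; ring

end Interpolation

/-! ### Quantitative decay of all derivatives with the `L²` norm -/

section Decay

/-- `∫ ‖∂^α h‖²` is finite and is a genuine integral for smooth `h` with `D^m h ∈ L²`. [folklore] -/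
theorem integrable_sq_norm_vderiv {h : EuclideanSpace ℝ (Fin 3) → EuclideanSpace ℝ (Fin 3)}
    (hh : ContDiff ℝ ∞ h) {m : ℕ} (hm : ∫⁻ x, ‖iteratedFDeriv ℝ m h x‖ₑ ^ 2 < ⊤) (α : Fin m → Fin 3) :
    Integrable (fun x => ‖vderiv α h x‖ ^ 2) volume :=
  FluidPDE.integrable_sq_norm_of_lintegral_lt_top (contDiff_vderiv hh α).continuous
    (lintegral_enorm_sq_lt_top_of_norm_le (fun x => by
      have := norm_iteratedFDeriv_vderiv_le hh α 0 x
      rw [norm_iteratedFDeriv_zero, zero_add] at this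
      exact this) hm)

/-- **All derivatives decay with the `L²` norm, quantitatively.** For every sequence of bounds
`B` and every order `m` there is `c ≥ 0` such that every smooth `h : ℝ³ → ℝ³` with
`∫ ‖Dʲh‖² ≤ B j` for all `j` satisfies `Σ_{|α|=m} ∫‖∂^α h‖² ≤ c (∫‖h‖²)^{2^{-m}}` (iterate the
one-step interpolation `sum_integral_sq_vderiv_succ_le`). [folklore] -/
theorem exists_sum_integral_sq_vderiv_le (B : ℕ → ℝ≥0) :
    ∀ m : ℕ, ∃ c : ℝ, 0 ≤ c ∧ ∀ h : EuclideanSpace ℝ (Fin 3) → EuclideanSpace ℝ (Fin 3),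
      ContDiff ℝ ∞ h → (∀ j, ∫⁻ x, ‖iteratedFDeriv ℝ j h x‖ₑ ^ 2 ≤ B j) →
        ∑ α : Fin m → Fin 3, ∫ x, ‖vderiv α h x‖ ^ 2 ≤
          c * (∫ x, ‖h x‖ ^ 2) ^ ((1 / 2 : ℝ) ^ m)
  | 0 => by
      refine ⟨1, zero_le_one, fun h _ _ => ?_⟩
      rw [pow_zero, Real.rpow_one, one_mul, Fintype.sum_unique]
      exact le_of_eq (by simp)
  | m + 1 => by
      obtain ⟨c, hc0, hc⟩ := exists_sum_integral_sq_vderiv_le B m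
      set b : ℝ := Real.sqrt ((B (m + 2) : ℝ)) with hb
      refine ⟨3 * (3 ^ m * (b * Real.sqrt c)), by positivity, fun h hh hB => ?_⟩
      have hfin : ∀ j, ∫⁻ x, ‖iteratedFDeriv ℝ j h x‖ₑ ^ 2 < ⊤ := fun j =>
        (hB j).trans_lt ENNReal.coe_lt_top
      have h1 := sum_integral_sq_vderiv_succ_le hh m (hfin m) (hfin (m + 1)) (hfin (m + 2))
      set t : ℝ := ∫ x, ‖h x‖ ^ 2 with ht
      have ht0 : 0 ≤ t := integral_nonneg fun x => sq_nonneg _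
      have hIH := hc h hh hB
      -- `√(∫ ‖D^{m+2} h‖²) ≤ b`
      have hD : Real.sqrt (∫ x, ‖iteratedFDeriv ℝ (m + 2) h x‖ ^ 2) ≤ b := by
        rw [hb]
        refine Real.sqrt_le_sqrt ?_
        have iD : Integrable (fun x => ‖iteratedFDeriv ℝ (m + 2) h x‖ ^ 2) volume :=
          FluidPDE.integrable_sq_norm_of_lintegral_lt_top
            (hh.continuous_iteratedFDeriv (m := m + 2) (WithTop.coe_le_coe.2 le_top)) (hfin (m + 2))
        have h2 : ENNReal.ofReal (∫ x, ‖iteratedFDeriv ℝ (m + 2) h x‖ ^ 2) ≤ (B (m + 2) : ℝ≥0∞) := by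
          rw [ofReal_integral_sq_norm iD]; exact hB (m + 2)
        have := ENNReal.toReal_mono ENNReal.coe_ne_top h2
        rwa [ENNReal.toReal_ofReal (integral_nonneg fun x => sq_nonneg _), ENNReal.coe_toReal] at this
      -- each `√(∫‖∂^β h‖²) ≤ √(c t^s)`
      have hx0 : ∀ β : Fin m → Fin 3, 0 ≤ ∫ x, ‖vderiv β h x‖ ^ 2 := fun β =>
        integral_nonneg fun x => sq_nonneg _
      have hsq : ∀ β : Fin m → Fin 3, Real.sqrt (∫ x, ‖vderiv β h x‖ ^ 2) ≤
          Real.sqrt (c * t ^ ((1 / 2 : ℝ) ^ m)) := fun β =>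
        Real.sqrt_le_sqrt ((Finset.single_le_sum (fun β _ => hx0 β) (Finset.mem_univ β)).trans hIH)
      have hsum : ∑ β : Fin m → Fin 3, Real.sqrt (∫ x, ‖vderiv β h x‖ ^ 2) *
          Real.sqrt (∫ x, ‖iteratedFDeriv ℝ (m + 2) h x‖ ^ 2) ≤
          ∑ _β : Fin m → Fin 3, Real.sqrt (c * t ^ ((1 / 2 : ℝ) ^ m)) * b :=
        Finset.sum_le_sum fun β _ => mul_le_mul (hsq β) hD (Real.sqrt_nonneg _) (Real.sqrt_nonneg _)
      rw [Finset.sum_const, Finset.card_univ, Fintype.card_fun, Fintype.card_fin, Fintype.card_fin,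
        nsmul_eq_mul] at hsum
      have hsplit : Real.sqrt (c * t ^ ((1 / 2 : ℝ) ^ m)) = Real.sqrt c * t ^ ((1 / 2 : ℝ) ^ (m + 1)) := by
        rw [Real.sqrt_mul hc0]
        congr 1
        rw [Real.sqrt_eq_rpow, ← Real.rpow_mul ht0, pow_succ]
      rw [hsplit] at hsum
      calc ∑ α : Fin (m + 1) → Fin 3, ∫ x, ‖vderiv α h x‖ ^ 2
          ≤ 3 * ∑ β : Fin m → Fin 3, Real.sqrt (∫ x, ‖vderiv β h x‖ ^ 2) *
              Real.sqrt (∫ x, ‖iteratedFDeriv ℝ (m + 2) h x‖ ^ 2) := h1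
        _ ≤ 3 * (((3 : ℕ) ^ m : ℕ) * (Real.sqrt c * t ^ ((1 / 2 : ℝ) ^ (m + 1)) * b)) := by
            gcongr
        _ = 3 * (3 ^ m * (b * Real.sqrt c)) * t ^ ((1 / 2 : ℝ) ^ (m + 1)) := by push_cast; ring

/-- **The `L²` norms of all derivatives decay with the `L²` norm of the field**: for every `B` and
`m` there is `c' ≥ 0` with `∫⁻ ‖Dᵐh‖ₑ² ≤ ofReal (c' (∫‖h‖²)^{2^{-m}})` for all smooth `h` with
`∫⁻ ‖Dʲh‖ₑ² ≤ B j` (`exists_sum_integral_sq_vderiv_le` and `‖Dᵐh‖² ≤ 3^{m+1} Σ_α ‖∂^αh‖²`). [folklore] -/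
theorem exists_lintegral_iteratedFDeriv_le_rpow (B : ℕ → ℝ≥0) (m : ℕ) :
    ∃ c' : ℝ, 0 ≤ c' ∧ ∀ h : EuclideanSpace ℝ (Fin 3) → EuclideanSpace ℝ (Fin 3),
      ContDiff ℝ ∞ h → (∀ j, ∫⁻ x, ‖iteratedFDeriv ℝ j h x‖ₑ ^ 2 ≤ B j) →
        ∫⁻ x, ‖iteratedFDeriv ℝ m h x‖ₑ ^ 2 ≤
          ENNReal.ofReal (c' * (∫ x, ‖h x‖ ^ 2) ^ ((1 / 2 : ℝ) ^ m)) := by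
  obtain ⟨c, hc0, hc⟩ := exists_sum_integral_sq_vderiv_le B m
  refine ⟨3 ^ (m + 1) * c, by positivity, fun h hh hB => ?_⟩
  have hfin : ∫⁻ x, ‖iteratedFDeriv ℝ m h x‖ₑ ^ 2 < ⊤ := (hB m).trans_lt ENNReal.coe_lt_top
  obtain ⟨hint, -⟩ := integrable_levelSq_of_lintegral_lt_top hh m hfin
  refine (lintegral_sq_norm_iteratedFDeriv_le hh m hint).trans (ENNReal.ofReal_le_ofReal ?_)
  have hlev : ∫ x, levelSq m h x = ∑ α : Fin m → Fin 3, ∫ x, ‖vderiv α h x‖ ^ 2 := by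
    rw [← integral_finsetSum _ fun α _ => integrable_sq_norm_vderiv hh hfin α]
    exact integral_congr_ae (Eventually.of_forall fun x => (sum_sq_norm_vderiv_eq_levelSq hh m x).symm)
  rw [hlev, mul_assoc]
  exact mul_le_mul_of_nonneg_left (hc h hh hB) (by positivity)

end Decay

/-! ### Uniform smallness of all derivatives (Sobolev imbedding `H² ⊂ C_B`) -/

section Sup

/-- `‖f‖_{L²} ≤ (ofReal A)^{1/2}` from `∫⁻ ‖f‖ₑ² ≤ ofReal A`. [folklore] -/
theorem eLpNorm_two_le_sqrt_of_lintegral_le {G : Type*} [NormedAddCommGroup G]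
    {f : EuclideanSpace ℝ (Fin 3) → G} {A : ℝ} (hA : 0 ≤ A)
    (h : ∫⁻ x, ‖f x‖ₑ ^ 2 ≤ ENNReal.ofReal A) :
    eLpNorm f 2 volume ≤ ENNReal.ofReal (Real.sqrt A) := by
  rw [eLpNorm_two_eq_rpow, Real.sqrt_eq_rpow, ← ENNReal.ofReal_rpow_of_nonneg hA (by norm_num)]
  exact ENNReal.rpow_le_rpow h (by norm_num)

/-- **Uniform smallness of the `k`-th derivative** (Sobolev imbedding `W^{2,2}(ℝ³) ⊂ C_B(ℝ³)`,
`FunctionSpaces.exists_enorm_le_sobolev_two_two_dim_three`, applied to the word derivatives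
`∂^α h`, and the decay `exists_lintegral_iteratedFDeriv_le_rpow`): for all bounds `B` and every
order `k` there is a function `Φ` with `Φ(t) → 0` as `t → 0` such that every smooth `h : ℝ³ → ℝ³`
with `∫⁻ ‖Dʲh‖ₑ² ≤ B j` for all `j` satisfies `‖Dᵏh(x)‖ ≤ Φ(∫‖h‖²)` for all `x`. [folklore] -/
theorem exists_norm_iteratedFDeriv_le_of_tendsto (B : ℕ → ℝ≥0) (k : ℕ) :
    ∃ Φ : ℝ → ℝ, Tendsto Φ (𝓝 0) (𝓝 0) ∧
      ∀ h : EuclideanSpace ℝ (Fin 3) → EuclideanSpace ℝ (Fin 3),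
        ContDiff ℝ ∞ h → (∀ j, ∫⁻ x, ‖iteratedFDeriv ℝ j h x‖ₑ ^ 2 ≤ B j) →
          ∀ x, ‖iteratedFDeriv ℝ k h x‖ ≤ Φ (∫ x, ‖h x‖ ^ 2) := by
  obtain ⟨K, hK, hS⟩ := FunctionSpaces.exists_enorm_le_sobolev_two_two_dim_three
    (E := EuclideanSpace ℝ (Fin 3)) (F := EuclideanSpace ℝ (Fin 3))
    (μ := (volume : Measure (EuclideanSpace ℝ (Fin 3)))) finrank_euclideanSpace_fin
  -- decay constants at the orders `k, k+1, k+2`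
  choose c hc0 hc using fun j => exists_lintegral_iteratedFDeriv_le_rpow B j
  set s : ℕ → ℝ := fun j => (1 / 2 : ℝ) ^ j with hs
  set R : ℝ → ℝ := fun t => ∑ j ∈ Finset.range 3, Real.sqrt (c (j + k) * |t| ^ s (j + k)) with hR
  refine ⟨fun t => Real.sqrt (3 ^ (k + 1) * 3 ^ k) * (K.toReal * R t), ?_, fun h hh hB x => ?_⟩
  · -- `Φ t → 0`
    have hR0 : Tendsto R (𝓝 0) (𝓝 0) := by
      have hRc : Continuous R := by
        rw [hR]
        refine continuous_finsetSum _ fun j _ => Real.continuous_sqrt.comp (continuous_const.mul ?_)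
        exact continuous_abs.rpow_const fun t => Or.inr (pow_pos (by norm_num) _).le
      have h0 : R 0 = 0 := by simp [hR, hs]
      have := hRc.tendsto 0
      rwa [h0] at this
    have := hR0.const_mul (K.toReal) |>.const_mul (Real.sqrt (3 ^ (k + 1) * 3 ^ k))
    simpa using this
  -- the bound
  have hfin : ∀ j, ∫⁻ x, ‖iteratedFDeriv ℝ j h x‖ₑ ^ 2 < ⊤ := fun j => (hB j).trans_lt ENNReal.coe_lt_top
  set t : ℝ := ∫ x, ‖h x‖ ^ 2 with ht
  have ht0 : 0 ≤ t := integral_nonneg fun x => sq_nonneg _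
  have hRt : R t = ∑ j ∈ Finset.range 3, Real.sqrt (c (j + k) * t ^ s (j + k)) := by
    simp [hR, abs_of_nonneg ht0]
  -- each word derivative is bounded by `K R t`
  have hword : ∀ α : Fin k → Fin 3, ‖vderiv α h x‖ ≤ K.toReal * R t := by
    intro α
    have hg : ContDiff ℝ ∞ (vderiv α h) := contDiff_vderiv hh α
    have h1 := hS (vderiv α h) (hg.of_le (by norm_cast)) x
    -- bound each `L²` norm
    have h2 : ∀ j ∈ Finset.range 3, eLpNorm (iteratedFDeriv ℝ j (vderiv α h)) 2 volume ≤
        ENNReal.ofReal (Real.sqrt (c (j + k) * t ^ s (j + k))) := by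
      intro j _
      refine eLpNorm_two_le_sqrt_of_lintegral_le (by
        exact mul_nonneg (hc0 _) (Real.rpow_nonneg ht0 _)) ?_
      calc ∫⁻ y, ‖iteratedFDeriv ℝ j (vderiv α h) y‖ₑ ^ 2 ≤ ∫⁻ y, ‖iteratedFDeriv ℝ (j + k) h y‖ₑ ^ 2 := by
            refine lintegral_mono fun y => ?_
            have hle := norm_iteratedFDeriv_vderiv_le hh α j y
            have : ‖iteratedFDeriv ℝ j (vderiv α h) y‖ₑ ≤ ‖iteratedFDeriv ℝ (j + k) h y‖ₑ := by
              rw [← ofReal_norm, ← ofReal_norm]; exact ENNReal.ofReal_le_ofReal hle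
            gcongr
        _ ≤ ENNReal.ofReal (c (j + k) * t ^ s (j + k)) := hc (j + k) h hh hB
    have h3 : (K * ∑ j ∈ Finset.range 3, eLpNorm (iteratedFDeriv ℝ j (vderiv α h)) 2 volume) ≤
        K * ∑ j ∈ Finset.range 3, ENNReal.ofReal (Real.sqrt (c (j + k) * t ^ s (j + k))) := by
      gcongr with j hj
      exact h2 j hj
    have h4 := h1.trans h3
    have hfinR : K * ∑ j ∈ Finset.range 3, ENNReal.ofReal (Real.sqrt (c (j + k) * t ^ s (j + k))) ≠ ⊤ :=
      ENNReal.mul_ne_top hK.ne (ENNReal.sum_ne_top.2 fun j _ => ENNReal.ofReal_ne_top)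
    have h5 := ENNReal.toReal_mono hfinR h4
    rw [toReal_enorm, ENNReal.toReal_mul, ENNReal.toReal_sum (fun j _ => ENNReal.ofReal_ne_top)] at h5
    rw [hRt]
    refine h5.trans (le_of_eq ?_)
    congr 1
    exact Finset.sum_congr rfl fun j _ => ENNReal.toReal_ofReal (Real.sqrt_nonneg _)
  -- from words to `Dᵏh`
  have hKR : 0 ≤ K.toReal * R t := by
    rw [hRt]; exact mul_nonneg ENNReal.toReal_nonneg (Finset.sum_nonneg fun j _ => Real.sqrt_nonneg _)
  have hsq : ‖iteratedFDeriv ℝ k h x‖ ^ 2 ≤ 3 ^ (k + 1) * 3 ^ k * (K.toReal * R t) ^ 2 := by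
    calc ‖iteratedFDeriv ℝ k h x‖ ^ 2 ≤ 3 ^ (k + 1) * levelSq k h x :=
          sq_norm_iteratedFDeriv_le_pow_mul_levelSq hh k x
      _ = 3 ^ (k + 1) * ∑ α : Fin k → Fin 3, ‖vderiv α h x‖ ^ 2 := by
          rw [sum_sq_norm_vderiv_eq_levelSq hh k x]
      _ ≤ 3 ^ (k + 1) * ∑ _α : Fin k → Fin 3, (K.toReal * R t) ^ 2 := by
          gcongr with α
          exact hword α
      _ = 3 ^ (k + 1) * 3 ^ k * (K.toReal * R t) ^ 2 := by
          rw [Finset.sum_const, Finset.card_univ, Fintype.card_fun, Fintype.card_fin, Fintype.card_fin,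
            nsmul_eq_mul]
          push_cast; ring
  have := Real.sqrt_le_sqrt hsq
  rw [Real.sqrt_sq (norm_nonneg _), Real.sqrt_mul (by positivity), Real.sqrt_sq hKR] at this
  exact this

end Sup

/-! ### The smooth representative -/

section Representative

/-- Telescoping bounds: `∫⁻ ‖Dᵏ(f m − f n)‖ₑ² ≤ 4 C k` for a family with `∫⁻ ‖Dᵏ(f n)‖ₑ² ≤ C k`. [folklore] -/
theorem lintegral_iteratedFDeriv_sub_le {f : ℕ → EuclideanSpace ℝ (Fin 3) → EuclideanSpace ℝ (Fin 3)}
    (hf : ∀ n, ContDiff ℝ ∞ (f n)) {C : ℕ → ℝ≥0}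
    (hC : ∀ k n, ∫⁻ x, ‖iteratedFDeriv ℝ k (f n) x‖ₑ ^ 2 ≤ C k) (k m n : ℕ) :
    ∫⁻ x, ‖iteratedFDeriv ℝ k (fun y => f m y - f n y) x‖ₑ ^ 2 ≤ ((4 * C k : ℝ≥0) : ℝ≥0∞) := by
  have heq : ∀ x, iteratedFDeriv ℝ k (fun y => f m y - f n y) x =
      iteratedFDeriv ℝ k (f m) x - iteratedFDeriv ℝ k (f n) x := fun x =>
    fun_iteratedFDeriv_sub_apply ((hf m).of_le (WithTop.coe_le_coe.2 le_top)).contDiffAt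
      ((hf n).of_le (WithTop.coe_le_coe.2 le_top)).contDiffAt
  calc ∫⁻ x, ‖iteratedFDeriv ℝ k (fun y => f m y - f n y) x‖ₑ ^ 2
      = ∫⁻ x, ‖iteratedFDeriv ℝ k (f m) x - iteratedFDeriv ℝ k (f n) x‖ₑ ^ 2 :=
        lintegral_congr fun x => by rw [heq]
    _ ≤ 2 * (∫⁻ x, ‖iteratedFDeriv ℝ k (f m) x‖ₑ ^ 2) + 2 * ∫⁻ x, ‖iteratedFDeriv ℝ k (f n) x‖ₑ ^ 2 :=
        lintegral_enorm_sq_sub_le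
          (((hf m).continuous_iteratedFDeriv (m := k) (WithTop.coe_le_coe.2 le_top)).aestronglyMeasurable)
    _ ≤ 2 * (C k : ℝ≥0∞) + 2 * (C k : ℝ≥0∞) := by
        gcongr
        · exact hC k m
        · exact hC k n
    _ = ((4 * C k : ℝ≥0) : ℝ≥0∞) := by push_cast; ring

/-- An `L²` field with `∫⁻ ‖D⁰f‖ₑ² ≤ C` is in `L²` (bookkeeping). [folklore] -/
theorem memLp_two_of_lintegral_iteratedFDeriv_zero_le {f : EuclideanSpace ℝ (Fin 3) → EuclideanSpace ℝ (Fin 3)}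
    (hf : ContDiff ℝ ∞ f) {C : ℝ≥0} (hC : ∫⁻ x, ‖iteratedFDeriv ℝ 0 f x‖ₑ ^ 2 ≤ C) : MemLp f 2 volume := by
  refine ⟨hf.continuous.aestronglyMeasurable, eLpNorm_two_lt_top_of_lintegral_enorm_sq_lt_top ?_⟩
  refine lt_of_le_of_lt ((le_of_eq (lintegral_congr fun x => ?_)).trans hC) ENNReal.coe_lt_top
  rw [← ofReal_norm, ← ofReal_norm, norm_iteratedFDeriv_zero]

/-- **`(f n)` is Cauchy in every `Cᵏ` sup-seminorm**: for smooth fields with uniformly bounded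
Sobolev norms of all orders converging in `L²`, `sup_x ‖Dᵏ(f m − f n)(x)‖ → 0` as `m, n → ∞`
(`exists_norm_iteratedFDeriv_le_of_tendsto` applied to the differences). [folklore] -/
theorem eventually_norm_iteratedFDeriv_sub_le
    {f : ℕ → EuclideanSpace ℝ (Fin 3) → EuclideanSpace ℝ (Fin 3)}
    {fl : EuclideanSpace ℝ (Fin 3) → EuclideanSpace ℝ (Fin 3)} (hf : ∀ n, ContDiff ℝ ∞ (f n))
    {C : ℕ → ℝ≥0} (hC : ∀ k n, ∫⁻ x, ‖iteratedFDeriv ℝ k (f n) x‖ₑ ^ 2 ≤ C k)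
    (hfl : MemLp fl 2 volume) (hconv : Tendsto (fun n => eLpNorm (f n - fl) 2 volume) atTop (𝓝 0))
    (k : ℕ) {ε : ℝ} (hε : 0 < ε) :
    ∀ᶠ p : ℕ × ℕ in atTop, ∀ x, ‖iteratedFDeriv ℝ k (fun y => f p.1 y - f p.2 y) x‖ ≤ ε := by
  obtain ⟨Φ, hΦ, hΦb⟩ := exists_norm_iteratedFDeriv_le_of_tendsto (fun j => 4 * C j) k
  have hf2 : ∀ n, MemLp (f n) 2 volume := fun n => memLp_two_of_lintegral_iteratedFDeriv_zero_le (hf n) (hC 0 n)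
  -- `a n = ‖f n − fl‖_{L²} → 0` (real numbers)
  set a : ℕ → ℝ := fun n => (eLpNorm (f n - fl) 2 volume).toReal with ha
  have ha0 : Tendsto a atTop (𝓝 0) := by
    have h := (ENNReal.tendsto_toReal ENNReal.zero_ne_top).comp hconv
    rwa [ENNReal.toReal_zero] at h
  -- `t (m, n) = ∫ ‖f m − f n‖² ≤ (a m + a n)²`
  have ht : ∀ m n, ∫ x, ‖f m x - f n x‖ ^ 2 ≤ (a m + a n) ^ 2 := by
    intro m n
    have hsub : eLpNorm (fun x => f m x - f n x) 2 volume ≤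
        eLpNorm (f m - fl) 2 volume + eLpNorm (f n - fl) 2 volume := by
      have heq : (fun x => f m x - f n x) = (f m - fl) - (f n - fl) := by funext x; simp
      rw [heq]
      exact eLpNorm_sub_le ((hf2 m).sub hfl).1 ((hf2 n).sub hfl).1 one_le_two
    have hfin1 : eLpNorm (f m - fl) 2 volume ≠ ⊤ := ((hf2 m).sub hfl).eLpNorm_ne_top
    have hfin2 : eLpNorm (f n - fl) 2 volume ≠ ⊤ := ((hf2 n).sub hfl).eLpNorm_ne_top
    have hmn : MemLp (fun x => f m x - f n x) 2 volume := (hf2 m).sub (hf2 n)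
    have h1 : ∫ x, ‖f m x - f n x‖ ^ 2 = (eLpNorm (fun x => f m x - f n x) 2 volume).toReal ^ 2 := by
      rw [← ENNReal.toReal_pow, ← lintegral_enorm_sq_eq_eLpNorm_two_sq,
        ← ofReal_integral_sq_norm ((memLp_two_iff_integrable_sq_norm hmn.1).1 hmn),
        ENNReal.toReal_ofReal (integral_nonneg fun x => sq_nonneg _)]
    rw [h1]
    refine pow_le_pow_left₀ ENNReal.toReal_nonneg ?_ 2
    have h2 := ENNReal.toReal_mono (ENNReal.add_ne_top.2 ⟨hfin1, hfin2⟩) hsub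
    rwa [ENNReal.toReal_add hfin1 hfin2] at h2
  -- `t → 0` along `atTop` of `ℕ × ℕ`
  have htend : Tendsto (fun p : ℕ × ℕ => ∫ x, ‖f p.1 x - f p.2 x‖ ^ 2) atTop (𝓝 0) := by
    have hup : Tendsto (fun p : ℕ × ℕ => (a p.1 + a p.2) ^ 2) atTop (𝓝 0) := by
      rw [← prod_atTop_atTop_eq]
      have h1 : Tendsto (fun p : ℕ × ℕ => a p.1) (atTop ×ˢ atTop) (𝓝 0) := ha0.comp tendsto_fst
      have h2 : Tendsto (fun p : ℕ × ℕ => a p.2) (atTop ×ˢ atTop) (𝓝 0) := ha0.comp tendsto_snd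
      simpa using (h1.add h2).pow 2
    exact tendsto_of_tendsto_of_tendsto_of_le_of_le tendsto_const_nhds hup
      (fun p => integral_nonneg fun x => sq_nonneg _) (fun p => ht p.1 p.2)
  have hcomp := hΦ.comp htend
  filter_upwards [hcomp.eventually (gt_mem_nhds hε)] with p hp x
  have hd : ContDiff ℝ ∞ (fun y => f p.1 y - f p.2 y) := (hf p.1).sub (hf p.2)
  have hb : ∀ j, ∫⁻ x, ‖iteratedFDeriv ℝ j (fun y => f p.1 y - f p.2 y) x‖ₑ ^ 2 ≤ (4 * C j : ℝ≥0) :=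
    fun j => lintegral_iteratedFDeriv_sub_le hf hC j p.1 p.2
  exact (hΦb _ hd hb x).trans (le_of_lt hp)

set_option maxHeartbeats 800000 in
/-- **Smooth representatives of `L²` limits of smooth fields with uniformly bounded Sobolev norms**
(folklore completeness of `H^∞(ℝ³)`; the "smooth for positive times" step of Robinson–Rodrigo–
Sadowski 2016, Thm. 7.3/7.5 and Tao 2013, Prop. 5.6, for limits of approximating classical
solutions). Let `f n : ℝ³ → ℝ³` be smooth with `∫⁻ ‖Dᵏ(f n)‖ₑ² ≤ C k` for all `k, n`, and let
`f n → fl` in `L²`. Then there is a smooth `g` with `g = fl` a.e. and `∫⁻ ‖Dᵏg‖ₑ² ≤ C k` for all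
`k`; if every `f n` is divergence free, so is `g`. Proof: `(f n)` is Cauchy in every `Cᵏ`
sup-seminorm (`eventually_norm_iteratedFDeriv_sub_le`); along a fast subsequence the telescoping
series has summable sup bounds, so its sum `g` is smooth with derivatives the limits of the
derivatives (Mathlib `contDiff_tsum`, `iteratedFDeriv_tsum_apply`); Fatou gives the bounds and an
a.e.-convergent subsequence identifies `g` with `fl`. (Heartbeat budget raised: one long
bookkeeping proof.) [folklore] -/
theorem exists_smooth_representative {f : ℕ → EuclideanSpace ℝ (Fin 3) → EuclideanSpace ℝ (Fin 3)}
    {fl : EuclideanSpace ℝ (Fin 3) → EuclideanSpace ℝ (Fin 3)} (hf : ∀ n, ContDiff ℝ ∞ (f n))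
    {C : ℕ → ℝ≥0} (hC : ∀ k n, ∫⁻ x, ‖iteratedFDeriv ℝ k (f n) x‖ₑ ^ 2 ≤ C k)
    (hfl : MemLp fl 2 volume) (hconv : Tendsto (fun n => eLpNorm (f n - fl) 2 volume) atTop (𝓝 0)) :
    ∃ g : EuclideanSpace ℝ (Fin 3) → EuclideanSpace ℝ (Fin 3), ContDiff ℝ ∞ g ∧ g =ᵐ[volume] fl ∧
      (∀ k, ∫⁻ x, ‖iteratedFDeriv ℝ k g x‖ₑ ^ 2 ≤ C k) ∧
      ((∀ n, VectorCalculus.IsDivFree (f n)) → VectorCalculus.IsDivFree g) := by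
  classical
  -- Step 1: the fast subsequence
  have hP : ∀ j : ℕ, ∀ᶠ n in atTop, ∀ m, n ≤ m → ∀ k, k ≤ j → ∀ x,
      ‖iteratedFDeriv ℝ k (fun y => f m y - f n y) x‖ ≤ (1 / 2 : ℝ) ^ j := by
    intro j
    have hev : ∀ᶠ p : ℕ × ℕ in atTop, ∀ k ∈ Finset.range (j + 1), ∀ x,
        ‖iteratedFDeriv ℝ k (fun y => f p.1 y - f p.2 y) x‖ ≤ (1 / 2 : ℝ) ^ j :=
      (Finset.range (j + 1)).eventually_all.2 fun k _ =>
        eventually_norm_iteratedFDeriv_sub_le hf hC hfl hconv k (by positivity)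
    rw [← prod_atTop_atTop_eq] at hev
    obtain ⟨a, -, ha⟩ := (atTop_basis.prod_self.eventually_iff).1 hev
    refine eventually_atTop.2 ⟨a, fun n hn m hm k hk x => ?_⟩
    have hmem : ((m, n) : ℕ × ℕ) ∈ Ici a ×ˢ Ici a := ⟨(hn.trans hm : a ≤ m), hn⟩
    exact ha hmem k (Finset.mem_range.2 (Nat.lt_succ_of_le hk)) x
  obtain ⟨φ, hφm, hφ⟩ := extraction_forall_of_eventually hP
  -- Step 2: the telescoping differences and their summable sup bounds
  obtain ⟨d, hd⟩ : ∃ d : ℕ → EuclideanSpace ℝ (Fin 3) → EuclideanSpace ℝ (Fin 3),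
      d = fun j y => f (φ (j + 1)) y - f (φ j) y := ⟨_, rfl⟩
  have hdj : ∀ j, d j = fun y => f (φ (j + 1)) y - f (φ j) y := fun j => by rw [hd]
  have hdC : ∀ j, ContDiff ℝ ∞ (d j) := fun j => by rw [hdj]; exact (hf _).sub (hf _)
  have hdb : ∀ j k, k ≤ j → ∀ x, ‖iteratedFDeriv ℝ k (d j) x‖ ≤ (1 / 2 : ℝ) ^ j := fun j k hk x => by
    rw [hdj]; exact hφ j (φ (j + 1)) (hφm.monotone (Nat.le_succ j)) k hk x
  have hdB : ∀ j i, ∫⁻ x, ‖iteratedFDeriv ℝ i (d j) x‖ₑ ^ 2 ≤ (4 * C i : ℝ≥0) := fun j i => by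
    rw [hdj]; exact lintegral_iteratedFDeriv_sub_le hf hC i _ _
  choose Φ hΦ0 hΦb using fun k => exists_norm_iteratedFDeriv_le_of_tendsto (fun i => 4 * C i) k
  obtain ⟨v, hvdef⟩ : ∃ v : ℕ → ℕ → ℝ,
      v = fun k j => (1 / 2 : ℝ) ^ j + if j < k then Φ k (∫ x, ‖d j x‖ ^ 2) else 0 := ⟨_, rfl⟩
  have hvkj : ∀ k j, v k j = (1 / 2 : ℝ) ^ j + if j < k then Φ k (∫ x, ‖d j x‖ ^ 2) else 0 :=
    fun k j => by rw [hvdef]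
  have hv : ∀ k, Summable (v k) := by
    intro k
    rw [hvdef]
    refine (summable_geometric_of_lt_one (by norm_num) (by norm_num)).add ?_
    refine summable_of_ne_finset_zero (s := Finset.range k) fun j hj => ?_
    rw [Finset.mem_range] at hj
    simp [hj]
  have hvb : ∀ k j x, ‖iteratedFDeriv ℝ k (d j) x‖ ≤ v k j := by
    intro k j x
    rw [hvkj]
    by_cases hjk : j < k
    · rw [if_pos hjk]
      have h1 := hΦb k (d j) (hdC j) (hdB j) x
      have h2 : (0 : ℝ) ≤ (1 / 2 : ℝ) ^ j := by positivity
      linarith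
    · rw [if_neg hjk, add_zero]
      exact hdb j k (not_lt.1 hjk) x
  -- Step 3: the series and its smoothness
  have htop : ∀ k : ℕ, ((k : ℕ∞) : WithTop ℕ∞) ≤ ((⊤ : ℕ∞) : WithTop ℕ∞) :=
    fun k => WithTop.coe_le_coe.2 le_top
  have hgs : ContDiff ℝ ∞ (fun x => ∑' j, d j x) :=
    contDiff_tsum (N := (⊤ : ℕ∞)) hdC (fun k _ => hv k) (fun k j x _ => hvb k j x)
  obtain ⟨g, hgdef⟩ : ∃ g : EuclideanSpace ℝ (Fin 3) → EuclideanSpace ℝ (Fin 3),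
      g = fun x => f (φ 0) x + ∑' j, d j x := ⟨_, rfl⟩
  have hg : ContDiff ℝ ∞ g := by rw [hgdef]; exact (hf (φ 0)).add hgs
  -- Step 4: the derivatives of `g` are the limits of the derivatives of `f (φ n)`
  have hDk : ∀ k x, Tendsto (fun n => iteratedFDeriv ℝ k (f (φ n)) x) atTop
      (𝓝 (iteratedFDeriv ℝ k g x)) := by
    intro k x
    have hsumm : Summable fun j => iteratedFDeriv ℝ k (d j) x :=
      Summable.of_norm_bounded (hv k) (fun j => hvb k j x)
    have hseries : iteratedFDeriv ℝ k (fun y => ∑' j, d j y) x = ∑' j, iteratedFDeriv ℝ k (d j) x :=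
      iteratedFDeriv_tsum_apply (N := (⊤ : ℕ∞)) hdC (fun k _ => hv k) (fun k j x _ => hvb k j x) le_top x
    have hgk : iteratedFDeriv ℝ k g x = iteratedFDeriv ℝ k (f (φ 0)) x + ∑' j, iteratedFDeriv ℝ k (d j) x := by
      rw [hgdef, ← hseries]
      exact fun_iteratedFDeriv_add_apply ((hf (φ 0)).of_le (htop k)).contDiffAt
        (hgs.of_le (htop k)).contDiffAt
    have htel : ∀ n, ∑ j ∈ Finset.range n, iteratedFDeriv ℝ k (d j) x =
        iteratedFDeriv ℝ k (f (φ n)) x - iteratedFDeriv ℝ k (f (φ 0)) x := by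
      intro n
      have heq : ∀ j, iteratedFDeriv ℝ k (d j) x =
          iteratedFDeriv ℝ k (f (φ (j + 1))) x - iteratedFDeriv ℝ k (f (φ j)) x := fun j => by
        rw [hdj]
        exact fun_iteratedFDeriv_sub_apply ((hf _).of_le (htop k)).contDiffAt
          ((hf _).of_le (htop k)).contDiffAt
      simp_rw [heq]
      exact Finset.sum_range_sub (fun j => iteratedFDeriv ℝ k (f (φ j)) x) n
    have h1 := hsumm.hasSum.tendsto_sum_nat
    rw [hgk]
    have h2 := h1.add_const (iteratedFDeriv ℝ k (f (φ 0)) x)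
    rw [add_comm] at h2
    refine h2.congr fun n => ?_
    rw [htel]; abel
  -- pointwise convergence of the fields themselves
  have hpt : ∀ x, Tendsto (fun n => f (φ n) x) atTop (𝓝 (g x)) := by
    intro x
    have h := hDk 0 x
    have e0 : ∀ (w : EuclideanSpace ℝ (Fin 3) → EuclideanSpace ℝ (Fin 3)),
        (iteratedFDeriv ℝ 0 w x) (fun _ => 0) = w x := fun w => iteratedFDeriv_zero_apply _
    have hc : Continuous fun L : (EuclideanSpace ℝ (Fin 3)) [×0]→L[ℝ] EuclideanSpace ℝ (Fin 3) =>
        L (fun _ => 0) := continuous_eval_const _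
    have := (hc.tendsto _).comp h
    simpa [Function.comp_def, e0] using this
  refine ⟨g, hg, ?_, fun k => ?_, fun hdiv => ?_⟩
  · -- Step 5: `g = fl` a.e.
    have hconv' : Tendsto (fun n => eLpNorm (f (φ n) - fl) 2 volume) atTop (𝓝 0) :=
      hconv.comp hφm.tendsto_atTop
    have hmeas := tendstoInMeasure_of_tendsto_eLpNorm (p := (2 : ℝ≥0∞)) two_ne_zero
      (fun n => (hf (φ n)).continuous.aestronglyMeasurable) hfl.1 hconv'
    obtain ⟨ns, hnsm, hns⟩ := hmeas.exists_seq_tendsto_ae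
    filter_upwards [hns] with x hx
    exact tendsto_nhds_unique ((hpt x).comp hnsm.tendsto_atTop) hx
  · -- Step 6: Fatou
    have hmeas : ∀ n, AEMeasurable (fun x => ‖iteratedFDeriv ℝ k (f (φ n)) x‖ₑ ^ 2) volume := fun n =>
      (continuous_enorm.comp ((hf (φ n)).continuous_iteratedFDeriv (m := k) (htop k))).aemeasurable.pow_const 2
    have hlim : ∀ x, Tendsto (fun n => ‖iteratedFDeriv ℝ k (f (φ n)) x‖ₑ ^ 2) atTop
        (𝓝 (‖iteratedFDeriv ℝ k g x‖ₑ ^ 2)) := fun x =>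
      ((ENNReal.continuous_pow 2).tendsto _).comp (hDk k x).enorm
    calc ∫⁻ x, ‖iteratedFDeriv ℝ k g x‖ₑ ^ 2
        = ∫⁻ x, liminf (fun n => ‖iteratedFDeriv ℝ k (f (φ n)) x‖ₑ ^ 2) atTop :=
          lintegral_congr fun x => ((hlim x).liminf_eq).symm
      _ ≤ liminf (fun n => ∫⁻ x, ‖iteratedFDeriv ℝ k (f (φ n)) x‖ₑ ^ 2) atTop := lintegral_liminf_le' hmeas
      _ ≤ C k := liminf_le_of_frequently_le (Frequently.of_forall fun n => hC k (φ n))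
  · -- Step 7: divergence free
    intro x
    set b := EuclideanSpace.basisFun (Fin 3) ℝ
    have hT : Tendsto (fun n => VectorCalculus.divergence (f (φ n)) x) atTop
        (𝓝 (VectorCalculus.divergence g x)) := by
      have heq : ∀ n, VectorCalculus.divergence (f (φ n)) x = ∑ i, ⟪b i, fderiv ℝ (f (φ n)) x (b i)⟫ :=
        fun n => divergence_eq_sum_inner_fderiv b _ _
      simp_rw [heq]
      rw [divergence_eq_sum_inner_fderiv b g x]
      refine tendsto_finsetSum _ fun i _ => ?_
      have hc : Continuous fun L : (EuclideanSpace ℝ (Fin 3)) [×1]→L[ℝ] EuclideanSpace ℝ (Fin 3) =>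
          L (fun _ => b i) := continuous_eval_const _
      have h1 := (hc.tendsto _).comp (hDk 1 x)
      have e1 : ∀ (w : EuclideanSpace ℝ (Fin 3) → EuclideanSpace ℝ (Fin 3)),
          (iteratedFDeriv ℝ 1 w x) (fun _ => b i) = fderiv ℝ w x (b i) := fun w => iteratedFDeriv_one_apply _
      have hfd : Tendsto (fun n => fderiv ℝ (f (φ n)) x (b i)) atTop (𝓝 (fderiv ℝ g x (b i))) := by
        simpa only [Function.comp_def, e1] using h1
      first
        | exact hfd.inner tendsto_const_nhds
        | exact (tendsto_const_nhds).inner hfd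
    have h0 : (fun n => VectorCalculus.divergence (f (φ n)) x) = fun _ => 0 := funext fun n => hdiv (φ n) x
    rw [h0] at hT
    exact (tendsto_nhds_unique tendsto_const_nhds hT).symm

end Representative

end Literature.Analysis.FluidPDE

end
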